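import Literature.Probability.RandomPlanarGeometry.SAWCountZdShapeCensus
import HarnessLib

/-!
# The shape census with O(1) displacement KEYS: zero blocks detected by comparing prefix-sum keys instead of walking back over the prefix

Topic `Literature/Probability/RandomPlanarGeometry` (upgrade (U1) of `SAWCountZdShapeCensus.lean` (a-p1 g23: state `ShSt`, update `shUpd`, class test
`shCls`, ★★★ `card_shapeClass_adjOf`) toward the `j = 5` census: the per-node cost of `shUpd` is the walk back over the whole prefix (`zeroMasks`,
O(len × n) list steps); here the state carries the PREFIX-SUM KEYS `(P_i, M_i)_{i ≤ len}` — `P_i = Σ_{p < i, sign +} W^{axis p}`, `M_i` likewise for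
sign `−` — and a block `[i₀, i)` is a zero block iff `P_i + M_{i₀} = M_i + P_{i₀}` (★ `keys_eq_iff_bsumW`, for a base `W > L`: the base-`W` digits of
`P_i − P_{i₀}` are the per-axis `+` counts of the block), so each new letter costs one addition and `len` comparisons of small numbers).

PRINTED CONTEXT (locators only). Madras–Slade (1993) Definition 1.2.4, §1.1 eq. (1.1.8) p. 5. The machinery is the lane's.

THIS FILE: `ShStK` (the keyed state), `zeroMasksK`, `shUpdK W`, `shOkK`, `shClsK`, `shVK`; the projection to the key-free fields of `ShSt`
(`st_shUpdK_proj`: `pre`, `len`, `cnt`, `rv` evolve exactly as under `shUpd`), the key invariant ★ `st_shUpdK_keys`, ★ `mem_zeroMasksK_iff`,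
★ `keys_eq_iff_bsumW`, ★★ `mem_zmK_iff` (the zero-block masks are those of the vanishing blocks of length `≥ 2`, as for `zmL`), ★★ `shClsK_st_iff`,
`shOkK_st_eq`, `prefixOK_shOkK_iff`, and ★★★ `card_shapeClass_adjOf_keys`:
`#shapeClass_j(u, A_c) = 2^(u−j) · dfsN alwR (shUpdK W) (shOkK u (u−j)) shClsK c (u−j) u shS0K 0` for every base `W > u`.
`dfsN_keys_eq_dfsN` (the two engines agree digit by digit) and the kernel cell `shVK_eight` (the keyed engine reproduces `shTab8`).
The definitions `ShStK`, `shS0K`, `zeroMasksK`, `shUpdK`, `shOkK`, `shClsK`, `shVK`, `plusKey`, `minusKey`, `keyList`, `ShStK.proj`, `ShSt.proj` are this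
file's tool notions.
[cite: MadrasSlade1993, Definition 1.2.4; §1.1 eq. (1.1.8) p. 5]

Provenance: lane «pcv-sawmu», a-p1 g23 (2026-08-27); design `HOME/pub-sawmu-a-p1/g23/eps5/DESIGN-next-car-epsilon5.md` (U1).
-/

open Finset
open scoped BigOperators
open Literature.Probability.LatticeModels
open Literature.Probability.RandomPlanarGeometry.SAW
open Literature.Probability.Percolation

namespace Literature.Probability.RandomPlanarGeometry.SAW.Zd

namespace WordTypes

/-! ### The keyed state and its update -/

section kdefs

/-- The keyed search state: the key-free fields of `ShSt` (`pre`, `len`, `cnt`, `rv`, `zm`) plus the prefix-sum keys `(P_i, M_i)` of all prefixes,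
newest first. [cite: MadrasSlade1993, Definition 1.2.4; lane tool notion] -/
structure ShStK where
  /-- reversed raw prefix -/
  pre : List (ℕ × Bool)
  /-- prefix length -/
  len : ℕ
  /-- occurrence counts per axis -/
  cnt : List ℕ
  /-- reversal-pair mask -/
  rv : ℕ
  /-- zero-block pair masks -/
  zm : List ℕ
  /-- prefix-sum keys `(P_i, M_i)`, `i = len, len − 1, …, 0` -/
  keys : List (ℕ × ℕ)

/-- The keyed state of the empty prefix (one key pair `(0, 0)`). [cite: MadrasSlade1993, Definition 1.2.4; lane tool notion] -/
def shS0K : ShStK := ⟨[], 0, [], 0, [], [(0, 0)]⟩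

/-- Comparing the new key pair `(P, M)` of the prefix of length `len'` with the older pairs `(P_i, M_i)`, `i = i, i−1, …`: the pair masks of the
zero blocks `[i₀, len')` of length `≥ 2` (`P + M_{i₀} = M + P_{i₀}`). [cite: MadrasSlade1993, Definition 1.2.4; lane tool notion] -/
def zeroMasksK (len' P M : ℕ) : ℕ → List (ℕ × ℕ) → List ℕ
  | _, [] => []
  | i, q :: rest => (if i + 2 ≤ len' ∧ P + q.2 = M + q.1 then [pairMask i len'] else []) ++ zeroMasksK len' P M (i - 1) rest

/-- Keyed state update by one raw letter (`W` = the key base). [cite: MadrasSlade1993, Definition 1.2.4; lane tool notion] -/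
def shUpdK (W : ℕ) (s : ShStK) (a : ℕ × Bool) : ShStK :=
  let P := (s.keys.headD (0, 0)).1 + (if a.2 then W ^ a.1 else 0)
  let M := (s.keys.headD (0, 0)).2 + (if a.2 then 0 else W ^ a.1)
  { pre := a :: s.pre
    len := s.len + 1
    cnt := bumpCnt s.cnt a.1
    rv := s.rv ||| revBit s.pre s.len a
    zm := s.zm ++ zeroMasksK (s.len + 1) P M s.len s.keys
    keys := (P, M) :: s.keys }

/-- The pruning test (same formula as `shOk`). [cite: MadrasSlade1993, Definition 1.2.4; lane tool notion] -/
def shOkK (u r : ℕ) (s : ShStK) : Bool :=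
  decide (s.cnt.length ≤ r) && decide (2 * (r - s.cnt.length) + (s.cnt.map (2 - ·)).sum ≤ u - s.len)

/-- The class test (same formula as `shCls`). [cite: MadrasSlade1993, Definition 1.2.4; lane tool notion] -/
def shClsK (c : ℕ) (s : ShStK) : Bool :=
  (c &&& s.rv == 0) && s.zm.any fun b => b &&& c == b

/-- The keyed census value for word length `u`, `r` axes, key base `u + 1`. [cite: MadrasSlade1993, Definition 1.2.4; lane tool notion] -/
def shVK (u r B : ℕ) : ℕ := dfsV alwR (shUpdK (u + 1)) (shOkK u r) shClsK (2 ^ (u - 1)) (u + 1) B u shS0K 0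

end kdefs

/-! ### The key-free fields evolve as before -/

section kproj

variable (W n : ℕ)

/-- The key-free projection of a keyed state (without `zm`). [cite: MadrasSlade1993, Definition 1.2.4; lane plumbing] -/
def ShStK.proj (s : ShStK) : List (ℕ × Bool) × ℕ × List ℕ × ℕ := (s.pre, s.len, s.cnt, s.rv)

/-- The corresponding projection of an `ShSt`. [cite: MadrasSlade1993, Definition 1.2.4; lane plumbing] -/
def ShSt.proj (s : ShSt) : List (ℕ × Bool) × ℕ × List ℕ × ℕ := (s.pre, s.len, s.cnt, s.rv)

/-- One update step commutes with the projection. [cite: MadrasSlade1993, Definition 1.2.4; lane plumbing] -/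
theorem proj_shUpdK (s : ShStK) (s' : ShSt) (h : s.proj = s'.proj) (a : ℕ × Bool) : (shUpdK W s a).proj = (shUpd n s' a).proj := by
  unfold ShStK.proj ShSt.proj at *
  simp only [Prod.mk.injEq] at h
  obtain ⟨h1, h2, h3, h4⟩ := h
  simp [shUpdK, shUpd, h1, h2, h3, h4]

/-- ★ The keyed state of a prefix has the same `pre`, `len`, `cnt`, `rv` as the key-free state. [cite: MadrasSlade1993, Definition 1.2.4; lane lemma] -/
theorem st_shUpdK_proj (w : List (ℕ × Bool)) : (st (shUpdK W) shS0K w).proj = (st (shUpd n) shS0 w).proj := by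
  induction w using List.reverseRecOn with
  | nil => rfl
  | append_singleton w a ih =>
    rw [st_append_singleton, st_append_singleton]
    exact proj_shUpdK W n _ _ ih a

/-- `len` of the keyed state. [cite: MadrasSlade1993, Definition 1.2.4; lane plumbing] -/
theorem st_shUpdK_len (w : List (ℕ × Bool)) : (st (shUpdK W) shS0K w).len = w.length := by
  have h := congrArg (fun p => p.2.1) (st_shUpdK_proj W 0 w)
  simp only [ShStK.proj, ShSt.proj] at h
  rw [h, st_shUpd_len]

/-- `cnt` of the keyed state. [cite: MadrasSlade1993, Definition 1.2.4; lane plumbing] -/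
theorem st_shUpdK_cnt (w : List (ℕ × Bool)) : (st (shUpdK W) shS0K w).cnt = (st (shUpd n) shS0 w).cnt := by
  have h := congrArg (fun p => p.2.2.1) (st_shUpdK_proj W n w)
  simpa [ShStK.proj, ShSt.proj] using h

/-- `rv` of the keyed state. [cite: MadrasSlade1993, Definition 1.2.4; lane plumbing] -/
theorem st_shUpdK_rv (w : List (ℕ × Bool)) : (st (shUpdK W) shS0K w).rv = (st (shUpd n) shS0 w).rv := by
  have h := congrArg (fun p => p.2.2.2) (st_shUpdK_proj W n w)
  simpa [ShStK.proj, ShSt.proj] using h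

/-- ★ The keyed pruning test agrees with `shOk` on every prefix. [cite: MadrasSlade1993, Definition 1.2.4; lane lemma] -/
theorem shOkK_st_eq (u r : ℕ) (w : List (ℕ × Bool)) : shOkK u r (st (shUpdK W) shS0K w) = shOk u r (st (shUpd n) shS0 w) := by
  unfold shOkK shOk
  rw [st_shUpdK_cnt W n, st_shUpdK_len, st_shUpd_len]

end kproj

/-! ### The keys and the zero-block masks -/

section kkeys

variable {L n : ℕ} (W : ℕ)

/-- The `+` key of the prefix of length `i`: `Σ_{p < i, (τ p).2 = true} W^{axis}`. [cite: MadrasSlade1993, Definition 1.2.4; lane tool notion] -/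
def plusKey (τ : Word L n) (i : ℕ) : ℕ :=
  ∑ p ∈ Finset.univ.filter (fun p : Fin L => p.val < i ∧ (τ p).2 = true), W ^ (τ p).1.val

/-- The `−` key of the prefix of length `i`. [cite: MadrasSlade1993, Definition 1.2.4; lane tool notion] -/
def minusKey (τ : Word L n) (i : ℕ) : ℕ :=
  ∑ p ∈ Finset.univ.filter (fun p : Fin L => p.val < i ∧ (τ p).2 = false), W ^ (τ p).1.val

/-- One more letter in the `+` key. [cite: MadrasSlade1993, Definition 1.2.4; lane plumbing] -/
theorem plusKey_succ (τ : Word L n) {i : ℕ} (hi : i < L) :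
    plusKey W τ (i + 1) = plusKey W τ i + (if (τ ⟨i, hi⟩).2 then W ^ (τ ⟨i, hi⟩).1.val else 0) := by
  unfold plusKey
  by_cases hs : (τ ⟨i, hi⟩).2 = true
  · rw [if_pos hs]
    have hsplit : Finset.univ.filter (fun p : Fin L => p.val < i + 1 ∧ (τ p).2 = true) =
        insert ⟨i, hi⟩ (Finset.univ.filter fun p : Fin L => p.val < i ∧ (τ p).2 = true) := by
      ext p
      simp only [Finset.mem_filter, Finset.mem_univ, true_and, Finset.mem_insert]
      constructor
      · rintro ⟨h1, h2⟩
        by_cases hp : p.val = i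
        · left; exact Fin.ext hp
        · right; exact ⟨by omega, h2⟩
      · rintro (rfl | ⟨h1, h2⟩)
        · exact ⟨by simp, hs⟩
        · exact ⟨by omega, h2⟩
    rw [hsplit, Finset.sum_insert (by simp), add_comm]
  · rw [if_neg hs, add_zero]
    congr 1
    ext p
    simp only [Finset.mem_filter, Finset.mem_univ, true_and]
    constructor
    · rintro ⟨h1, h2⟩
      refine ⟨?_, h2⟩
      rcases Nat.lt_succ_iff_lt_or_eq.1 h1 with h | h
      · exact h
      · exfalso; apply hs; have : p = ⟨i, hi⟩ := Fin.ext h; rw [← this]; exact h2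
    · rintro ⟨h1, h2⟩; exact ⟨by omega, h2⟩

/-- One more letter in the `−` key. [cite: MadrasSlade1993, Definition 1.2.4; lane plumbing] -/
theorem minusKey_succ (τ : Word L n) {i : ℕ} (hi : i < L) :
    minusKey W τ (i + 1) = minusKey W τ i + (if (τ ⟨i, hi⟩).2 then 0 else W ^ (τ ⟨i, hi⟩).1.val) := by
  unfold minusKey
  by_cases hs : (τ ⟨i, hi⟩).2 = true
  · rw [if_pos hs, add_zero]
    congr 1
    ext p
    simp only [Finset.mem_filter, Finset.mem_univ, true_and]
    constructor
    · rintro ⟨h1, h2⟩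
      refine ⟨?_, h2⟩
      rcases Nat.lt_succ_iff_lt_or_eq.1 h1 with h | h
      · exact h
      · exfalso; have : p = ⟨i, hi⟩ := Fin.ext h; rw [this] at h2; rw [h2] at hs; exact Bool.false_ne_true hs
    · rintro ⟨h1, h2⟩; exact ⟨by omega, h2⟩
  · rw [if_neg hs]
    have hs' : (τ ⟨i, hi⟩).2 = false := by simpa using hs
    have hsplit : Finset.univ.filter (fun p : Fin L => p.val < i + 1 ∧ (τ p).2 = false) =
        insert ⟨i, hi⟩ (Finset.univ.filter fun p : Fin L => p.val < i ∧ (τ p).2 = false) := by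
      ext p
      simp only [Finset.mem_filter, Finset.mem_univ, true_and, Finset.mem_insert]
      constructor
      · rintro ⟨h1, h2⟩
        by_cases hp : p.val = i
        · left; exact Fin.ext hp
        · right; exact ⟨by omega, h2⟩
      · rintro (rfl | ⟨h1, h2⟩)
        · exact ⟨by simp, hs'⟩
        · exact ⟨by omega, h2⟩
    rw [hsplit, Finset.sum_insert (by simp), add_comm]

/-- The key list of indices `i, i−1, …, 0`. [cite: MadrasSlade1993, Definition 1.2.4; lane plumbing] -/
def keyList (τ : Word L n) (i : ℕ) : List (ℕ × ℕ) := ((List.range (i + 1)).reverse).map fun i' => (plusKey W τ i', minusKey W τ i')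

/-- `keyList` unfolds from the top index. [cite: MadrasSlade1993, Definition 1.2.4; lane plumbing] -/
theorem keyList_succ (τ : Word L n) (i : ℕ) : keyList W τ (i + 1) = (plusKey W τ (i + 1), minusKey W τ (i + 1)) :: keyList W τ i := by
  unfold keyList
  rw [List.range_succ, List.reverse_append, List.reverse_singleton, List.singleton_append, List.map_cons]

/-- `keyList` starts with the newest key pair. [cite: MadrasSlade1993, Definition 1.2.4; lane plumbing] -/
theorem keyList_eq_cons (τ : Word L n) (i : ℕ) :
    keyList W τ i = (plusKey W τ i, minusKey W τ i) :: ((List.range i).reverse.map fun i' => (plusKey W τ i', minusKey W τ i')) := by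
  unfold keyList
  rw [List.range_succ, List.reverse_append, List.reverse_singleton, List.singleton_append, List.map_cons]

/-- ★ THE KEY INVARIANT: after the prefix of length `i ≤ L` the keyed state holds `keyList W τ i`. [cite: MadrasSlade1993, Definition 1.2.4; lane lemma] -/
theorem st_shUpdK_keys (τ : Word L n) : ∀ i, i ≤ L → (st (shUpdK W) shS0K ((rawW τ).take i)).keys = keyList W τ i := by
  intro i
  induction i with
  | zero =>
    intro _
    rw [List.take_zero]
    unfold keyList plusKey minusKey
    simp [st, shS0K]
  | succ i ih =>
    intro hi
    have hi' : i < L := Nat.lt_of_succ_le hi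
    rw [rawW_take_succ τ i hi', st_append_singleton]
    simp only [shUpdK]
    rw [ih hi'.le, keyList_succ, keyList_eq_cons W τ i, List.headD_cons, plusKey_succ W τ hi', minusKey_succ W τ hi']
    rfl

/-- ★ `zeroMasksK` read: the masks produced against `keyList W τ i` are those of the indices `i₀ ≤ i` with `i₀ + 2 ≤ len'` and
`P + M_{i₀} = M + P_{i₀}`. [cite: MadrasSlade1993, Definition 1.2.4; lane lemma] -/
theorem mem_zeroMasksK_iff (τ : Word L n) (len' P M b : ℕ) : ∀ i,
    b ∈ zeroMasksK len' P M i (keyList W τ i) ↔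
      ∃ i₀, i₀ ≤ i ∧ i₀ + 2 ≤ len' ∧ P + minusKey W τ i₀ = M + plusKey W τ i₀ ∧ b = pairMask i₀ len' := by
  intro i
  induction i with
  | zero =>
    unfold keyList
    simp only [zero_add, List.range_one, List.reverse_singleton, List.map_singleton, zeroMasksK, List.append_nil]
    constructor
    · intro h
      by_cases hc : 0 + 2 ≤ len' ∧ P + minusKey W τ 0 = M + plusKey W τ 0
      · rw [if_pos hc, List.mem_singleton] at h
        exact ⟨0, le_rfl, hc.1, hc.2, h⟩
      · rw [if_neg hc] at h; simp at h
    · rintro ⟨i₀, hi₀, h2, hk, hb⟩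
      have : i₀ = 0 := Nat.le_zero.1 hi₀
      subst this
      rw [if_pos ⟨h2, hk⟩, List.mem_singleton, hb]
  | succ i ih =>
    rw [keyList_succ, zeroMasksK, List.mem_append, Nat.add_sub_cancel, ih]
    constructor
    · rintro (h | ⟨i₀, hi₀, h2, hk, hb⟩)
      · by_cases hc : i + 1 + 2 ≤ len' ∧ P + minusKey W τ (i + 1) = M + plusKey W τ (i + 1)
        · rw [if_pos hc, List.mem_singleton] at h
          exact ⟨i + 1, le_rfl, hc.1, hc.2, h⟩
        · rw [if_neg hc] at h; simp at h
      · exact ⟨i₀, by omega, h2, hk, hb⟩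
    · rintro ⟨i₀, hi₀, h2, hk, hb⟩
      rcases Nat.eq_or_lt_of_le hi₀ with rfl | hlt
      · left; rw [if_pos ⟨h2, hk⟩, List.mem_singleton, hb]
      · right; exact ⟨i₀, by omega, h2, hk, hb⟩

/-- The `+` key over a block: `plusKey i = plusKey i₀ + Σ_{p ∈ [i₀, i), +} W^{axis}` (`i₀ ≤ i`). [cite: MadrasSlade1993, Definition 1.2.4; lane plumbing] -/
theorem plusKey_eq_add (τ : Word L n) {i₀ i : ℕ} (h : i₀ ≤ i) :
    plusKey W τ i = plusKey W τ i₀ +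
      ∑ p ∈ Finset.univ.filter (fun p : Fin L => (i₀ ≤ p.val ∧ p.val < i) ∧ (τ p).2 = true), W ^ (τ p).1.val := by
  unfold plusKey
  rw [← Finset.sum_union]
  · congr 1
    ext p
    simp only [Finset.mem_filter, Finset.mem_univ, true_and, Finset.mem_union]
    constructor
    · rintro ⟨h1, h2⟩
      by_cases hp : p.val < i₀
      · left; exact ⟨hp, h2⟩
      · right; exact ⟨⟨by omega, h1⟩, h2⟩
    · rintro (⟨h1, h2⟩ | ⟨⟨h1, h1'⟩, h2⟩)
      · exact ⟨by omega, h2⟩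
      · exact ⟨h1', h2⟩
  · rw [Finset.disjoint_filter]
    intro p _ h1 h2; omega

/-- The `−` key over a block. [cite: MadrasSlade1993, Definition 1.2.4; lane plumbing] -/
theorem minusKey_eq_add (τ : Word L n) {i₀ i : ℕ} (h : i₀ ≤ i) :
    minusKey W τ i = minusKey W τ i₀ +
      ∑ p ∈ Finset.univ.filter (fun p : Fin L => (i₀ ≤ p.val ∧ p.val < i) ∧ (τ p).2 = false), W ^ (τ p).1.val := by
  unfold minusKey
  rw [← Finset.sum_union]
  · congr 1
    ext p
    simp only [Finset.mem_filter, Finset.mem_univ, true_and, Finset.mem_union]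
    constructor
    · rintro ⟨h1, h2⟩
      by_cases hp : p.val < i₀
      · left; exact ⟨hp, h2⟩
      · right; exact ⟨⟨by omega, h1⟩, h2⟩
    · rintro (⟨h1, h2⟩ | ⟨⟨h1, h1'⟩, h2⟩)
      · exact ⟨by omega, h2⟩
      · exact ⟨h1', h2⟩
  · rw [Finset.disjoint_filter]
    intro p _ h1 h2; omega

/-- A signed sum of powers over a set of positions, regrouped by axis: `Σ_{p ∈ t, sign s} W^{axis p} = Σ_x #{p ∈ t : τ p = (x, s)} · W^x`.
[cite: MadrasSlade1993, Definition 1.2.4; lane plumbing] -/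
theorem sum_pow_eq_sum_count (τ : Word L n) (t : Finset (Fin L)) (s : Bool) :
    ∑ p ∈ t.filter (fun p => (τ p).2 = s), W ^ (τ p).1.val = ∑ x : Fin n, (t.filter fun p => τ p = (x, s)).card * W ^ x.val := by
  rw [← Finset.sum_fiberwise (t.filter fun p => (τ p).2 = s) (fun p => (τ p).1) (fun p => W ^ (τ p).1.val)]
  refine Finset.sum_congr rfl fun x _ => ?_
  rw [Finset.filter_filter]
  have hset : (t.filter fun p => (τ p).2 = s ∧ (τ p).1 = x) = t.filter fun p => τ p = (x, s) := by
    refine Finset.filter_congr fun p _ => ?_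
    rw [Prod.ext_iff]
    exact ⟨fun h => ⟨h.2, h.1⟩, fun h => ⟨h.2, h.1⟩⟩
  rw [hset, Finset.sum_congr rfl (fun p hp => by rw [(Finset.mem_filter.1 hp).2]), Finset.sum_const, smul_eq_mul]

/-- Base-`W` digit vectors are determined by their value: `Σ_x c x W^x = Σ_x d x W^x` with all digits `< W` forces `c = d`.
[cite: MadrasSlade1993, Definition 1.2.4; lane plumbing] -/
theorem eq_of_sum_mul_pow_eq {W : ℕ} (c d : Fin n → ℕ) (hc : ∀ x, c x < W) (hd : ∀ x, d x < W)
    (h : ∑ x : Fin n, c x * W ^ x.val = ∑ x : Fin n, d x * W ^ x.val) : c = d := by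
  set c' : ℕ → ℕ := fun i => if hi : i < n then c ⟨i, hi⟩ else 0 with hc'
  set d' : ℕ → ℕ := fun i => if hi : i < n then d ⟨i, hi⟩ else 0 with hd'
  have h1 : ∑ x : Fin n, c x * W ^ x.val = ∑ i ∈ Finset.range n, c' i * W ^ i := by
    rw [← Fin.sum_univ_eq_sum_range (fun i => c' i * W ^ i) n]
    refine Finset.sum_congr rfl fun x _ => ?_
    rw [hc']; simp [x.isLt]
  have h2 : ∑ x : Fin n, d x * W ^ x.val = ∑ i ∈ Finset.range n, d' i * W ^ i := by
    rw [← Fin.sum_univ_eq_sum_range (fun i => d' i * W ^ i) n]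
    refine Finset.sum_congr rfl fun x _ => ?_
    rw [hd']; simp [x.isLt]
  rw [h1, h2, sum_mul_pow_eq_ofDigits, sum_mul_pow_eq_ofDigits] at h
  have hl := ofDigits_inj_of_length_eq _ _ (by simp) (fun y hy => ?_) (fun y hy => ?_) h
  · funext x
    have := congrArg (fun l => l[x.val]?) hl
    simp only [List.getElem?_map, List.getElem?_range x.isLt, Option.map_some] at this
    have hx := Option.some.inj this
    rw [hc', hd'] at hx
    simpa [x.isLt] using hx
  · obtain ⟨i, hin, rfl⟩ := List.mem_map.1 hy
    have hin' : i < n := List.mem_range.1 hin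
    show c' i < W
    simp only [hc', dif_pos hin']; exact hc _
  · obtain ⟨i, hin, rfl⟩ := List.mem_map.1 hy
    have hin' : i < n := List.mem_range.1 hin
    show d' i < W
    simp only [hd', dif_pos hin']; exact hd _

/-- ★ KEY EQUALITY ⇔ ZERO BLOCK: for `i₀ ≤ i ≤ L` and a base `W > L`, `P_i + M_{i₀} = M_i + P_{i₀}` iff the block `[i₀, i)` sums to zero.
[cite: MadrasSlade1993, Definition 1.2.4; lane lemma] -/
theorem keys_eq_iff_bsumW (τ : Word L n) (hW : L < W) {i₀ i : ℕ} (h : i₀ ≤ i) :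
    plusKey W τ i + minusKey W τ i₀ = minusKey W τ i + plusKey W τ i₀ ↔ bsumW τ i₀ i = 0 := by
  set t := Finset.univ.filter (fun p : Fin L => i₀ ≤ p.val ∧ p.val < i) with ht
  have hP := plusKey_eq_add W τ h
  have hM := minusKey_eq_add W τ h
  rw [← Finset.filter_filter, ← ht, sum_pow_eq_sum_count] at hP hM
  rw [hP, hM, bsumW, ← ht, sum_twoStepV_eq_zero_iff]
  have hbound : ∀ (s : Bool) (x : Fin n), (t.filter fun p => τ p = (x, s)).card < W := fun s x =>
    lt_of_le_of_lt ((Finset.card_filter_le _ _).trans ((Finset.card_le_univ _).trans (by simp))) hW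
  constructor
  · intro hk
    have heq : ∑ x : Fin n, (t.filter fun p => τ p = (x, true)).card * W ^ x.val =
        ∑ x : Fin n, (t.filter fun p => τ p = (x, false)).card * W ^ x.val := by omega
    have := eq_of_sum_mul_pow_eq _ _ (hbound true) (hbound false) heq
    intro x
    have hx := congrFun this x
    exact_mod_cast hx
  · intro hbal
    have : ∑ x : Fin n, (t.filter fun p => τ p = (x, true)).card * W ^ x.val =
        ∑ x : Fin n, (t.filter fun p => τ p = (x, false)).card * W ^ x.val := by
      refine Finset.sum_congr rfl fun x _ => ?_
      have hx := hbal x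
      have : (t.filter fun p => τ p = (x, true)).card = (t.filter fun p => τ p = (x, false)).card := by exact_mod_cast hx
      rw [this]
    omega

end kkeys

/-! ### The zero-block masks of the keyed state, the class test, and the count theorem -/

section kcount

variable {L n : ℕ} (W : ℕ)

/-- One more letter: the new masks come from comparing the new key pair with `keyList W τ i`. [cite: MadrasSlade1993, Definition 1.2.4; lane plumbing] -/
theorem st_shUpdK_zm_succ (τ : Word L n) {i : ℕ} (hi : i < L) :
    (st (shUpdK W) shS0K ((rawW τ).take (i + 1))).zm =
      (st (shUpdK W) shS0K ((rawW τ).take i)).zm ++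
        zeroMasksK (i + 1) (plusKey W τ (i + 1)) (minusKey W τ (i + 1)) i (keyList W τ i) := by
  have hlen : (st (shUpdK W) shS0K ((rawW τ).take i)).len = i := by
    rw [st_shUpdK_len]; simp [rawW, hi.le]
  rw [rawW_take_succ τ i hi, st_append_singleton]
  simp only [shUpdK]
  rw [st_shUpdK_keys W τ i hi.le, keyList_eq_cons W τ i, List.headD_cons, plusKey_succ W τ hi, minusKey_succ W τ hi, hlen,
    ← keyList_eq_cons W τ i]
  rfl

/-- ★ The masks of the keyed state of a prefix (`i ≤ L`, base `W > L`): those of the zero blocks `[i₀, i₁)` of length `≥ 2` with `i₁ ≤ i`.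
[cite: MadrasSlade1993, Definition 1.2.4; lane lemma] -/
theorem mem_zmK_prefix_iff (τ : Word L n) (hW : L < W) (b : ℕ) : ∀ i, i ≤ L →
    (b ∈ (st (shUpdK W) shS0K ((rawW τ).take i)).zm ↔
      ∃ i₀ i₁, i₀ + 2 ≤ i₁ ∧ i₁ ≤ i ∧ bsumW τ i₀ i₁ = 0 ∧ b = pairMask i₀ i₁) := by
  intro i
  induction i with
  | zero =>
    intro _
    rw [List.take_zero]
    simp only [st, List.foldl, shS0K, List.not_mem_nil, false_iff, not_exists, not_and]
    intro i₀ i₁ h1 h2; omega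
  | succ i ih =>
    intro hi
    have hi' : i < L := Nat.lt_of_succ_le hi
    rw [st_shUpdK_zm_succ W τ hi', List.mem_append, ih hi'.le, mem_zeroMasksK_iff]
    constructor
    · rintro (⟨i₀, i₁, h2, h1, hz, hb⟩ | ⟨i₀, hi₀, h2, hk, hb⟩)
      · exact ⟨i₀, i₁, h2, by omega, hz, hb⟩
      · exact ⟨i₀, i + 1, h2, le_rfl, (keys_eq_iff_bsumW W τ hW (by omega)).1 hk, hb⟩
    · rintro ⟨i₀, i₁, h2, h1, hz, hb⟩
      rcases Nat.eq_or_lt_of_le h1 with rfl | hlt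
      · right; exact ⟨i₀, by omega, h2, (keys_eq_iff_bsumW W τ hW (by omega)).2 hz, hb⟩
      · left; exact ⟨i₀, i₁, h2, by omega, hz, hb⟩

/-- ★★ THE ZERO-BLOCK MASKS OF THE KEYED STATE OF A WORD (base `W > L`): the same set as `zmL` — the pair masks of the vanishing blocks of
length `≥ 2`. [cite: MadrasSlade1993, Definition 1.2.4; lane lemma] -/
theorem mem_zmK_iff (τ : Word L n) (hW : L < W) (b : ℕ) :
    b ∈ (st (shUpdK W) shS0K (rawW τ)).zm ↔ ∃ i₀ i, i₀ + 2 ≤ i ∧ i ≤ L ∧ bsumW τ i₀ i = 0 ∧ b = pairMask i₀ i := by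
  have h := mem_zmK_prefix_iff W τ hW b L le_rfl
  rwa [List.take_of_length_le (by simp [rawW])] at h

/-- ★★ THE KEYED CLASS TEST READ (base `W > L`): `shClsK c` on the final keyed state ⇔ `RunNoRev (adjOf L c) τ ∧ RunHasRep (adjOf L c) τ`.
[cite: MadrasSlade1993, Definition 1.2.4; lane theorem] -/
theorem shClsK_st_iff (τ : Word L n) (hW : L < W) (c : ℕ) :
    shClsK c (st (shUpdK W) shS0K (rawW τ)) = true ↔ RunNoRev (adjOf L c) τ ∧ RunHasRep (adjOf L c) τ := by
  unfold shClsK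
  rw [Bool.and_eq_true, beq_iff_eq, land_eq_zero_iff', List.any_eq_true, st_shUpdK_rv W n]
  refine and_congr ?_ ?_
  · constructor
    · intro h i hi hA hrev
      apply h i.val
      refine ⟨?_, (testBit_rv_iff τ i.val).2 ⟨hi, ?_⟩⟩
      · unfold adjOf at hA; rw [Bool.and_eq_true] at hA; exact hA.2
      · have : (⟨i.val, by omega⟩ : Fin L) = i := Fin.ext rfl
        rw [this]; exact hrev
    · intro h k ⟨hc, hrv⟩
      obtain ⟨hk, hrev⟩ := (testBit_rv_iff τ k).1 hrv
      refine h ⟨k, by omega⟩ hk ?_ hrev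
      unfold adjOf; rw [Bool.and_eq_true, decide_eq_true_iff]; exact ⟨hk, hc⟩
  · constructor
    · rintro ⟨b, hb, hbc⟩
      rw [beq_iff_eq, land_eq_self_iff] at hbc
      obtain ⟨i₀, i, h2, hiL, hz, rfl⟩ := (mem_zmK_iff W τ hW b).1 hb
      refine ⟨i₀, i, by omega, hiL, fun k hk1 hk2 => ?_, (wordPos_eq_iff_bsumW τ (by omega) hiL).2 hz⟩
      unfold adjOf
      rw [Bool.and_eq_true, decide_eq_true_iff]
      exact ⟨by omega, hbc k.val ((testBit_pairMask i₀ i k.val).2 ⟨hk1, hk2⟩)⟩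
    · rintro ⟨i₀, i, hlt, hiL, hA, hpos⟩
      have hz : bsumW τ i₀ i = 0 := (wordPos_eq_iff_bsumW τ hlt.le hiL).1 hpos
      have h2 : i₀ + 2 ≤ i := by
        by_contra hh
        have : i = i₀ + 1 := by omega
        subst this
        exact bsumW_succ_ne_zero τ (by omega) hz
      refine ⟨pairMask i₀ i, (mem_zmK_iff W τ hW _).2 ⟨i₀, i, h2, hiL, hz, rfl⟩, ?_⟩
      rw [beq_iff_eq, land_eq_self_iff]
      intro k hk
      obtain ⟨hk1, hk2⟩ := (testBit_pairMask i₀ i k).1 hk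
      have := hA ⟨k, by omega⟩ hk1 hk2
      unfold adjOf at this; rw [Bool.and_eq_true] at this
      exact this.2

/-- ★ The keyed pruning test along the prefixes ⇔ every position repeated (as for `shOk`). [cite: MadrasSlade1993, Definition 1.2.4; lane lemma] -/
theorem prefixOK_shOkK_iff (τ : Word L n) (hg : GrowthOK τ) {r : ℕ} (hr : numAxes τ = r) :
    PrefixOK (shUpdK W) (shOkK L r) shS0K τ ↔ ∀ p, IsRep τ p := by
  rw [← prefixOK_shOk_iff (n := n) τ hg hr]
  unfold PrefixOK
  refine forall_congr' fun i => ?_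
  rw [shOkK_st_eq W n]

open Classical in
/-- ★★★ THE SHAPE COUNT THEOREM, KEYED ENGINE: for every base `W > u`,
`#shapeClass_j(u, A_c) = 2^(u−j) · dfsN alwR (shUpdK W) (shOkK u (u−j)) shClsK c (u−j) u shS0K 0`. [cite: MadrasSlade1993, Definition 1.2.4; lane theorem] -/
theorem card_shapeClass_adjOf_keys (j u c W : ℕ) (hju : j ≤ u) (hW : u < W) :
    (shapeClass j u (adjOf u c)).card = 2 ^ (u - j) * dfsN alwR (shUpdK W) (shOkK u (u - j)) shClsK c (u - j) u shS0K 0 := by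
  rw [shapeClass_eq_filter_TL j u c hju,
    card_filter_eq_two_pow_mul_card (TL u) flipW_mem_TL (ShapeP u c) (fun S τ => shapeP_flipW_iff c S τ) (u - j),
    ← card_TL_class alwR (shUpdK W) (shOkK u (u - j)) shClsK shS0K c (u - j), Finset.filter_filter]
  congr 2
  refine Finset.filter_congr fun τ hτ => ?_
  have hg : GrowthOK τ := (growthOK_iff_canon_eq τ).2 (canon_TL τ hτ)
  rw [rgA_alwR_iff]
  constructor
  · rintro ⟨⟨⟨h1, h2, h3⟩, hfp⟩, hr⟩
    exact ⟨⟨⟨hg, hfp⟩, (prefixOK_shOkK_iff W τ hg hr).2 h1, (shClsK_st_iff W τ hW c).2 ⟨h2, h3⟩⟩, hr⟩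
  · rintro ⟨⟨⟨-, hfp⟩, hpre, hcls⟩, hr⟩
    exact ⟨⟨⟨(prefixOK_shOkK_iff W τ hg hr).1 hpre, (shClsK_st_iff W τ hW c).1 hcls⟩, hfp⟩, hr⟩

/-- ★★ The two engines agree digit by digit: for `W > u` the keyed census counts equal the walk-back census counts.
[cite: MadrasSlade1993, Definition 1.2.4; lane corollary] -/
theorem dfsN_keys_eq_dfsN (j u c W : ℕ) (hju : j ≤ u) (hW : u < W) :
    dfsN alwR (shUpdK W) (shOkK u (u - j)) shClsK c (u - j) u shS0K 0 = dfsN alwR (shUpd u) (shOk u (u - j)) shCls c (u - j) u shS0 0 := by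
  have h1 := card_shapeClass_adjOf_keys j u c W hju hW
  have h2 := card_shapeClass_adjOf j u c hju
  have hpos : 0 < 2 ^ (u - j) := Nat.two_pow_pos _
  exact Nat.eq_of_mul_eq_mul_left hpos (h1.symm.trans h2)

end kcount

/-! ### Demonstration cell: the keyed engine reproduces the `u = 8` excess-four census table -/

section kdemo

/-- ★ KERNEL CELL (keyed engine, `u = 8`, `j = 4`): the keyed census value equals the table `shTab8` of `SAWCountZdShapeCensus` — the two engines
agree on all `128 × 9` digits (as `dfsN_keys_eq_dfsN` predicts), at a fraction of the walk-back cost per node.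
[cite: MadrasSlade1993, Definition 1.2.4; lane census] -/
theorem shVK_eight : shVK 8 4 (2 ^ 33) = Nat.ofDigits ((2 ^ 33) ^ 9) (shTab8.map (Nat.ofDigits (2 ^ 33))) := by
  decide +kernel

end kdemo

end WordTypes

end Literature.Probability.RandomPlanarGeometry.SAW.Zd
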